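import Summits.QuantumFields.YangMills.Theorems.UnitScaleTiltProp7ProjectorPerturbationGram
import Summits.QuantumFields.YangMills.Theorems.UnitScaleTiltProp7ColumnPairingRows
import Summits.QuantumFields.YangMills.Theorems.UnitScaleTiltProp7GramInverseDifferenceRow
import HarnessLib

/-!
# Route `UnitScaleTilt`, crux K1 «MinimiserStabilityRegPr» (stmt-QuantumFields-19200), EX row `hGF[Lift]` (curved member) — **LOD LINE, PEN (L5″) FILE 2h (ABSTRACT, THE SINGLE TARGET):
# `hloc` FROM THREE LOCAL VECTOR ROWS** — the composition ✓`Prop7ProjectorPerturbationGram` ∘ ✓`Prop7ColumnPairingRows` ∘ ✓`Prop7GramInverseDifferenceRow` in ONE statement: for two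
# massive-column systems `v_y = G_W(T_W(b_y))`, `v′_y = G_1(T_1(b_y))` over one orthonormal coarse basis `b` (symmetric `G`, adjoint pairs `(S, T)`, Gram matrices `M, M′`, projections
# `P, P′` onto `K ⊆ span v`, `K′ ⊆ span v′`), the GLOBAL sizes `‖S‖ ≤ C_S`, `‖G‖ ≤ C_G` (both systems), `‖M⁻¹‖ ≤ ν`, `‖M′⁻¹‖ ≤ ν′`, and THREE LOCAL ROWS AT THE VECTOR `f`:
# (RB1) `‖G_W f − G_1 f‖ ≤ c_G‖f‖`, (RB2) `‖S_W(G_1 f) − S_1(G_1 f)‖ ≤ c_Q‖f‖`, (RN) `√Σ‖((M′ − M)(M′⁻¹b_f))_y‖² ≤ δ_M‖f‖` (`(b_f)_y = ⟪v_y, f⟫`) give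
# **`‖⟪f, Pf − P′f⟫‖ ≤ (δ₁·ν·β + β′·ν·δ_M + β′·ν′·δ₁)·‖f‖²`**, `δ₁ = C_S·c_G + c_Q`, `β = C_S·C_G`, `β′ = C_S′·C_G′` — the `hloc` of ✓`Prop7PTermLocalGaugeKnit`∕✓`Prop7LocalComparisonKnit`.

Cell `ym3-torus` (HUMAN RULING D-0037, YM ladder rung R3 — NOT d = 4, NOT infinite volume, NOT a mass gap, NOT Clay).  Width seat `ym-routeR-w3` gen 12; ★p1 g24 LOCATE-L6-ASSEMBLY §1 Step
I.2 (L5″), road (α).  THEOREMS ONLY (0 `def`, 0 `sorry`); `--supports stmt-QuantumFields-19200 --as helper`, count-neutral.  HONEST LABEL (★★OWNER RULING №33 (6)): curved γ-row supplier line,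
pen (L5″); abstract Hilbert-space algebra — the three local rows are px5 g11's («MINE (RB2), (RB1)» 2026-08-30 01:08:53Z; (R-N) rides with them per routeR-w2 g12 01:28:50Z); nothing of (3.49),
Thm 3.1∕3.3, `h349`, `hGF`, EX ∕ 19200 is proved here.  Member letters: `E := SiteL2K` (fine), `C :=` coarse `SiteL2K`, `S := ι ∘ Q″`, `T` its adjoint, `G := G_a`, `b :=` px17's spike basis,
`K := ((ker Q″).map Δ)ᗮ` (so `Pf = f − projR Δ Q″ f`, ✓`Prop7ComplementaryProjectorColumns.sub_projR_eq_starProjection_orthogonal`), the two systems at `W = U₀^σ` and at `1`.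

WHAT IS PROVED (ns `Summit.QuantumFields.YangMills.Theorems.Prop7LocalProjectorRowOfMemberRows`).
* ★★★ `norm_inner_starProjection_sub_le_of_member_rows` (the statement above).

References: T. Bałaban, CMP **99** (1985) 389–434 [Balaban1985BackgroundPropagators] ((3.16) p.393, (3.20)–(3.25) pp.394–395, (3.49) p.399, (3.105) p.414).
-/

set_option autoImplicit false

noncomputable section

open scoped InnerProductSpace ComplexConjugate BigOperators Matrix Matrix.Norms.L2Operator

namespace Summit.QuantumFields.YangMills.Theorems.Prop7LocalProjectorRowOfMemberRows

open Summit.QuantumFields.YangMills.Theorems.Prop7ProjectorPerturbationGram (norm_inner_starProjection_sub_le)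
open Summit.QuantumFields.YangMills.Theorems.Prop7ColumnPairingRows (sqrt_sum_normSq_inner_column_le sqrt_sum_normSq_inner_column_sub_le)
open Summit.QuantumFields.YangMills.Theorems.Prop7GramInverseDifferenceRow (gramInv_difference_row)

variable {E C : Type*} [NormedAddCommGroup E] [InnerProductSpace ℂ E] [NormedAddCommGroup C] [InnerProductSpace ℂ C] {m : Type*} [Fintype m] [DecidableEq m]

/-- ★★★ **`hloc` FROM THREE LOCAL VECTOR ROWS** (see the module docstring for the letters): global sizes + (RB1) + (RB2) + (RN) at the vector `f` ⟹
`‖⟪f, Pf − P′f⟫‖ ≤ ((C_S·c_G + c_Q)·ν·(C_S·C_G) + (C_S′·C_G′)·(ν·δ_M) + (C_S′·C_G′)·ν′·(C_S·c_G + c_Q))·‖f‖²`.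
[cite: Balaban1985BackgroundPropagators, (3.20)–(3.25) pp.394–395, (3.49) p.399, (3.105) p.414] -/
theorem norm_inner_starProjection_sub_le_of_member_rows (b : OrthonormalBasis m ℂ C) (GW G1 : E →ₗ[ℂ] E) (TW T1 : C →ₗ[ℂ] E) (SW S1 : E →ₗ[ℂ] C)
    (hGW : ∀ x y : E, ⟪GW x, y⟫_ℂ = ⟪x, GW y⟫_ℂ) (hG1 : ∀ x y : E, ⟪G1 x, y⟫_ℂ = ⟪x, G1 y⟫_ℂ)
    (hTW : ∀ (l : E) (c : C), ⟪SW l, c⟫_ℂ = ⟪l, TW c⟫_ℂ) (hT1 : ∀ (l : E) (c : C), ⟪S1 l, c⟫_ℂ = ⟪l, T1 c⟫_ℂ)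
    {M M' : Matrix m m ℂ} (hM : ∀ y y', M y y' = ⟪GW (TW (b y)), GW (TW (b y'))⟫_ℂ) (hM' : ∀ y y', M' y y' = ⟪G1 (T1 (b y)), G1 (T1 (b y'))⟫_ℂ)
    (hunit : IsUnit M.det) (hunit' : IsUnit M'.det) (K K' : Submodule ℂ E) [K.HasOrthogonalProjection] [K'.HasOrthogonalProjection]
    (hvK : ∀ y, GW (TW (b y)) ∈ K) (hKv : K ≤ Submodule.span ℂ (Set.range fun y => GW (TW (b y))))
    (hvK' : ∀ y, G1 (T1 (b y)) ∈ K') (hKv' : K' ≤ Submodule.span ℂ (Set.range fun y => G1 (T1 (b y))))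
    {CS CS' CG CG' ν ν' cG cQ δM : ℝ} (hCS : 0 ≤ CS) (hCS' : 0 ≤ CS') (hCG' : 0 ≤ CG') (hν : 0 ≤ ν) (hν' : 0 ≤ ν') (hcG : 0 ≤ cG) (hcQ : 0 ≤ cQ)
    (hSW : ∀ l, ‖SW l‖ ≤ CS * ‖l‖) (hS1 : ∀ l, ‖S1 l‖ ≤ CS' * ‖l‖) (hGWb : ∀ h, ‖GW h‖ ≤ CG * ‖h‖) (hG1b : ∀ h, ‖G1 h‖ ≤ CG' * ‖h‖)
    (hN : ‖M⁻¹‖ ≤ ν) (hN' : ‖M'⁻¹‖ ≤ ν') (f : E)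
    (hRB1 : ‖GW f - G1 f‖ ≤ cG * ‖f‖) (hRB2 : ‖SW (G1 f) - S1 (G1 f)‖ ≤ cQ * ‖f‖)
    (hRN : Real.sqrt (∑ y, ‖((M' - M) *ᵥ (M'⁻¹ *ᵥ fun y' => ⟪GW (TW (b y')), f⟫_ℂ)) y‖ ^ 2) ≤ δM * ‖f‖) :
    ‖⟪f, K.starProjection f - K'.starProjection f⟫_ℂ‖
      ≤ ((CS * cG + cQ) * ν * (CS * CG) + (CS' * CG') * (ν * δM) + (CS' * CG') * ν' * (CS * cG + cQ)) * ‖f‖ ^ 2 := by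
  have hb := sqrt_sum_normSq_inner_column_le b GW TW SW hGW hTW hCS hSW hGWb f
  have ha' := sqrt_sum_normSq_inner_column_le b G1 T1 S1 hG1 hT1 hCS' hS1 hG1b f
  have h1 := sqrt_sum_normSq_inner_column_sub_le b GW G1 TW T1 SW S1 hGW hG1 hTW hT1 hCS hSW f hRB1 hRB2
  have h2 := gramInv_difference_row M M' hunit hunit' (fun y' => ⟪GW (TW (b y')), f⟫_ℂ) hN hRN
  have h := norm_inner_starProjection_sub_le (fun y => GW (TW (b y))) (fun y => G1 (T1 (b y))) hM hM' hunit hunit' K K' hvK hKv hvK' hKv' f f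
    hν hν' (by positivity) (by positivity) hN hN' hb ha' h1 h1 h2
  rw [sq]; simpa [mul_assoc] using h

end Summit.QuantumFields.YangMills.Theorems.Prop7LocalProjectorRowOfMemberRows

end
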